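import Mathlib
import HarnessLib
import Summits.PneNP.Statement
import Literature.Computability.Complexity.CNF
import Literature.Computability.Complexity.CookBridges
import Literature.Computability.Complexity.SearchToDecision

/-!
# PneNP / OverlapGapAlgebra — the assembly (stmt-PneNP-2461), route-independent proof

Route `PneNP/OverlapGapAlgebra`, assembly item stmt-PneNP-2461 (`Assembly`, rank 1):

  `EvalRelationInP → SearchHardWindow → PneNP`.

By contraposition over PROVED tree facts: if `¬ PneNP` then `NP ⊆ P` in Cook's Clay model, hence —
through the model bridges `p_bool_eq` / `CookBridges.np_bool_eq` (`CookBridges.lean`) —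
`Nondeterministic.NP ⊆ Classes.P`; search-to-decision (`exists_searchFn_of_NP_subset_P`,
`SearchToDecision.lean`; Arora–Barak 2009, Thm. 2.18) for the CNF-evaluation relation `R ∈ P` of the
hypothesis `EvalRelationInP` and the witness bound `p(N) = (⌈1/α⌉₊ + 1)(N + 1)` yields `g ∈ FP`
(hence `IsPolyTime g`) that returns a satisfying table whenever the instance is satisfiable (the
witness `List.ofFn σ` has length `n ≤ p(|x|)` because `|x| ≥ m = ⌊α n⌋₊ ≥ 1`), so
`Pr[g solves Φ] ≥ Pr[Φ satisfiable] ≥ ε` eventually, contradicting `Pr[g solves Φ] ≤ ε / 2`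
eventually (the hardness conjunct of `SearchHardWindow`).

This file deliberately does NOT import the route file `Summits.PneNP.PneNP.Theses.OverlapGapAlgebra`
(nor any `Theorems/OverlapGapAlgebra*.lean`): the gate links a proved item by importing the proving
module INTO the route file (`theorem Assembly_holds : Assembly := …`), which a module importing the
route file would turn into an import cycle (same convention as
`Theorems/SzkEntropyAssemblyStandalone.lean`, `Theorems/OverlapGapAlgebraSearchFromDecision.lean`).
The two hypotheses are therefore PASTED structurally — the bodies of the route decls
`EvalRelationInP` and `SearchHardWindow` verbatim — the conclusion is the summit statement
`_root_.PneNP`, and the proof repeats the route file's certified deciding theorem `closes` with its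
two "known" hypotheses `ClassBridges`, `SearchFromDecision` discharged by the tree theorems above.
The import cone added to the route consists of `CookBridges` and `SearchToDecision` (sorry-free
machine/bridge files without named facts), already the cones of the linked support items.

References: S. Arora, B. Barak, *Computational Complexity: A Modern Approach*, CUP 2009, §2.5,
Thm. 2.18 (decision versus search), Def. 1.13, Def. 2.1; S. Cook, *The P versus NP problem* (Clay
problem description, 2000), §1; D. Achlioptas, Y. Peres, *The threshold for random k-SAT is
2^k log 2 − O(k)*, JAMS 17 (2004), §1 (model) and §11, Question 2.
-/

namespace Summit.PneNP.PneNP.Theorems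

set_option linter.dupNamespace false -- `Summit.PneNP.PneNP.…`: summit = sub-problem (D-0017)

open Literature.Computability.Complexity

/-- **The assembly of route OverlapGapAlgebra** (item stmt-PneNP-2461; the type is literally the body
of `Summit.PneNP.PneNP.Theses.OverlapGapAlgebra.Assembly = EvalRelationInP → SearchHardWindow →
PneNP` with the two route decls unfolded): if CNF evaluation is a polynomial-time relation `R` and
random `k`-SAT at some density `α` is satisfiable with uniformly positive probability while every
polynomial-time `f` solves it with probability `→ 0`, then `P ≠ NP`.  Proof: were `P = NP`
(Cook's model, transported by `p_bool_eq` / `CookBridges.np_bool_eq`), search-to-decision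
(`exists_searchFn_of_NP_subset_P`, Arora–Barak Thm. 2.18) for `R` with witness bound
`(⌈1/α⌉₊ + 1)(N + 1)` gives a polynomial-time `g` solving every satisfiable instance, so
`ε ≤ Pr[sat] ≤ Pr[g solves] ≤ ε / 2` at a common large `n`, absurd.
[AroraBarakCC2009, Thm. 2.18; CookClay2006, §1; AchlioptasPeres2004, §11 Question 2] -/
theorem overlapGapAlgebra_assembly_proof :
    (∃ R ∈ Literature.Computability.Complexity.Classes.P, ∀ (φ : Literature.Computability.Complexity.CNF ℕ) (y : List Bool), Literature.Computability.Complexity.boolPair (Literature.Computability.Complexity.encodingCNF.encode φ) y ∈ R ↔ φ.eval (fun i => y.getD i false) = true) →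
    (∃ (k : ℕ) (α : ℝ), (∃ ε : ℝ, 0 < ε ∧ ∀ᶠ n : ℕ in Filter.atTop, ∀ m : ℕ, m = ⌊α * n⌋₊ → ε ≤ ((Finset.univ.filter fun Φ : Fin m → Fin k → Fin n × Bool => ∃ σ : Fin n → Bool, ∀ i, ∃ j, σ (Φ i j).1 = (Φ i j).2).card : ℝ) / Fintype.card (Fin m → Fin k → Fin n × Bool)) ∧ ∀ f : List Bool → List Bool, Literature.Computability.Complexity.IsPolyTime f → ∀ ε : ℝ, 0 < ε → ∀ᶠ n : ℕ in Filter.atTop, ∀ m : ℕ, m = ⌊α * n⌋₊ → ((Finset.univ.filter fun Φ : Fin m → Fin k → Fin n × Bool => ∀ i, ∃ j, (f (Literature.Computability.Complexity.encodingCNF.encode (List.ofFn fun a => List.ofFn fun b => (((Φ a b).1 : ℕ), (Φ a b).2)))).getD (Φ i j).1 false = (Φ i j).2).card : ℝ) / Fintype.card (Fin m → Fin k → Fin n × Bool) ≤ ε) →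
    _root_.PneNP := by
  intro hE hX
  by_contra hne
  -- (1) ¬ PneNP ⇒ NP ⊆ P in the `Classes` model, through the proved model bridges
  --     `p_bool_eq : PNPWave0.P Bool = Classes.P`, `np_bool_eq : PNPWave0.NP Bool = Nondeterministic.NP`
  have hsub : Literature.Computability.Complexity.Nondeterministic.NP ⊆
      Literature.Computability.Complexity.Classes.P := by
    intro L hL
    by_contra hL'
    exact hne ⟨L, CookBridges.np_bool_eq ▸ hL, p_bool_eq ▸ hL'⟩
  -- (2) the two route-specific hypotheses
  obtain ⟨R, hR, hRiff⟩ := hE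
  obtain ⟨k, α, ⟨ε, hε, hsat⟩, hhard⟩ := hX
  -- (3) search-to-decision (Arora–Barak Thm 2.18): a polynomial-time `g` returning a satisfying
  --     table whenever one of length ≤ p(|x|) exists, p(N) = (⌈1/α⌉₊+1)(N+1)
  obtain ⟨g, hgFP, hg⟩ := exists_searchFn_of_NP_subset_P hsub hR
    (Polynomial.C (⌈1 / α⌉₊ + 1) * (Polynomial.X + 1))
  have hgFP' : Literature.Computability.Complexity.PolyTimeComputable (id : List Bool → List Bool)
      (id : List Bool → List Bool) g := hgFP
  have hgpoly : Literature.Computability.Complexity.IsPolyTime g :=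
    (CookBridges.isPolyTime_iff g).2 hgFP'
  -- (4) a common index `n` of the two eventualities (success of `g` ≤ ε/2, satisfiability ≥ ε)
  obtain ⟨n, hn₁, hn₂⟩ := (hsat.and (hhard g hgpoly (ε / 2) (half_pos hε))).exists
  have h₁ := hn₁ _ rfl
  have h₂ := hn₂ _ rfl
  -- (5) length of a unary numeral
  have hlenU : ∀ j : ℕ, (Computability.unaryEncodeNat j).length = j := by
    intro j
    induction j with
    | zero => simp [Computability.unaryEncodeNat]
    | succ j ih => simp [Computability.unaryEncodeNat, ih]
  -- (6) every satisfiable instance is solved by `g`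
  have key : ∀ Φ : Fin ⌊α * (n : ℝ)⌋₊ → Fin k → Fin n × Bool,
      (∃ σ : Fin n → Bool, ∀ i, ∃ j, σ (Φ i j).1 = (Φ i j).2) →
      ∀ i, ∃ j, (g (Literature.Computability.Complexity.encodingCNF.encode
        (List.ofFn fun a => List.ofFn fun b => (((Φ a b).1 : ℕ), (Φ a b).2)))).getD (Φ i j).1 false
          = (Φ i j).2 := by
    intro Φ hΦ i
    obtain ⟨σ, hσ⟩ := hΦ
    set L : Literature.Computability.Complexity.CNF ℕ :=
      List.ofFn fun a => List.ofFn fun b => (((Φ a b).1 : ℕ), (Φ a b).2) with hL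
    -- evaluation of the clause list `L` under a table `τ`
    have evalIff : ∀ τ : ℕ → Bool, Literature.Computability.Complexity.CNF.eval L τ = true ↔
        ∀ a, ∃ b, τ ((Φ a b).1 : ℕ) = (Φ a b).2 := by
      intro τ
      rw [Literature.Computability.Complexity.CNF.eval, List.all_eq_true]
      constructor
      · intro h a
        have hmem : (List.ofFn fun b => (((Φ a b).1 : ℕ), (Φ a b).2)) ∈ L := by
          rw [hL]; exact List.mem_ofFn.2 ⟨a, rfl⟩
        obtain ⟨l, hl, hval⟩ := List.any_eq_true.1 (h _ hmem)
        obtain ⟨b, rfl⟩ := List.mem_ofFn.1 hl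
        exact ⟨b, by simpa [Literature.Computability.Complexity.Literal.eval] using hval⟩
      · intro h C hC
        rw [hL] at hC
        obtain ⟨a, rfl⟩ := List.mem_ofFn.1 hC
        obtain ⟨b, hb⟩ := h a
        exact List.any_eq_true.2 ⟨_, List.mem_ofFn.2 ⟨b, rfl⟩,
          by simpa [Literature.Computability.Complexity.Literal.eval] using hb⟩
    -- `m = ⌊α n⌋₊ ≥ 1` (we hold a clause index `i`), hence `α > 0`
    have hm0 : 0 < ⌊α * (n : ℝ)⌋₊ := i.pos
    have hα1 : (1 : ℝ) ≤ α * n := Nat.floor_pos.1 hm0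
    have hn0 : (0 : ℝ) ≤ n := Nat.cast_nonneg n
    have hα : 0 < α := by
      by_contra hα'
      have hα0 : α ≤ 0 := le_of_not_gt hα'
      nlinarith
    -- the input word is at least as long as the number of clauses
    have hxm : ⌊α * (n : ℝ)⌋₊ ≤ (Literature.Computability.Complexity.encodingCNF.encode L).length := by
      have hx' : Literature.Computability.Complexity.encodingCNF.encode L =
          Literature.Computability.Complexity.boolPair (Computability.unaryEncodeNat L.length)
            (L.foldr (fun a acc => Literature.Computability.Complexity.boolPair
              (Literature.Computability.Complexity.encodingClause.encode a) acc) []) := rfl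
      rw [hx', Literature.Computability.Complexity.length_boolPair, hlenU, hL, List.length_ofFn]
      omega
    -- the table of `σ` read back
    have hyget : ∀ v : Fin n, (List.ofFn σ).getD v false = σ v := by
      intro v
      simp [List.getD_eq_getElem?_getD]
    -- `⟨x, table of σ⟩ ∈ R`
    have hyR : Literature.Computability.Complexity.boolPair
        (Literature.Computability.Complexity.encodingCNF.encode L) (List.ofFn σ) ∈ R := by
      refine (hRiff L (List.ofFn σ)).2 ((evalIff _).2 fun a => ?_)
      obtain ⟨b, hb⟩ := hσ a
      exact ⟨b, (hyget _).trans hb⟩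
    -- hence `g` answers a satisfying table (the witness `List.ofFn σ` is short enough)
    have hspec : Literature.Computability.Complexity.boolPair
        (Literature.Computability.Complexity.encodingCNF.encode L)
        (g (Literature.Computability.Complexity.encodingCNF.encode L)) ∈ R := by
      refine (hg _ ⟨List.ofFn σ, ?_, hyR⟩).2
      simp only [Polynomial.eval_mul, Polynomial.eval_C, Polynomial.eval_add, Polynomial.eval_X,
        Polynomial.eval_one, List.length_ofFn]
      have hlt : (n : ℝ) * α < ⌊α * (n : ℝ)⌋₊ + 1 := by
        rw [mul_comm]; exact Nat.lt_floor_add_one _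
      have h1 : (n : ℝ) < (⌊α * (n : ℝ)⌋₊ + 1 : ℝ) * (⌈1 / α⌉₊ : ℕ) :=
        calc (n : ℝ) < (⌊α * (n : ℝ)⌋₊ + 1 : ℝ) / α := (lt_div_iff₀ hα).2 hlt
          _ = (⌊α * (n : ℝ)⌋₊ + 1 : ℝ) * (1 / α) := div_eq_mul_one_div _ _
          _ ≤ (⌊α * (n : ℝ)⌋₊ + 1 : ℝ) * (⌈1 / α⌉₊ : ℕ) :=
              mul_le_mul_of_nonneg_left (Nat.le_ceil _) (by positivity)
      have h2 : n < (⌊α * (n : ℝ)⌋₊ + 1) * ⌈1 / α⌉₊ := by exact_mod_cast h1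
      calc n ≤ (⌊α * (n : ℝ)⌋₊ + 1) * ⌈1 / α⌉₊ := h2.le
        _ ≤ ((Literature.Computability.Complexity.encodingCNF.encode L).length + 1) * ⌈1 / α⌉₊ :=
            Nat.mul_le_mul_right _ (Nat.add_le_add_right hxm 1)
        _ ≤ (⌈1 / α⌉₊ + 1) * ((Literature.Computability.Complexity.encodingCNF.encode L).length + 1) := by
            nlinarith
    -- read the answer of `g` back through `R`
    have hsolved := (evalIff _).1 ((hRiff L _).1 hspec)
    exact hsolved i
  -- (7) counting: Pr[satisfiable] ≤ Pr[g solves], so ε ≤ ε / 2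
  have hchain : ε ≤ ε / 2 := by
    refine h₁.trans (le_trans ?_ h₂)
    refine div_le_div_of_nonneg_right ?_ (Nat.cast_nonneg _)
    refine Nat.cast_le.2 (Finset.card_le_card fun Φ hΦ => ?_)
    simp only [Finset.mem_filter, Finset.mem_univ, true_and] at hΦ ⊢
    exact key Φ hΦ
  linarith

end Summit.PneNP.PneNP.Theorems
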